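import Literature.Analysis.FluidPDE.TorusLpOperatorFactsAntidivergenceProofs
import Literature.Analysis.FluidPDE.AntidivergenceLinear
import Literature.Analysis.FunctionSpaces.TorusRieszTransformProofs
import Literature.Analysis.FunctionSpaces.TorusEnstrophyOrthogonality
import HarnessLib

/-!
# `ℛ∂ₘ` is bounded on `L^p(𝕋^d)`, `1 < p < ∞`

Analysis/FluidPDE proof file (everything proved; no named facts). The De Lellis–Székelyhidi
antidivergence `ℛ` (`Torus.antidivergence`, Cheskidov–Luo 2022, Def. 7.2:
`(ℛv)ᵢⱼ = ∂ᵢΔ⁻¹vⱼ + ∂ⱼΔ⁻¹vᵢ - (d-1)⁻¹δᵢⱼ D + (2-d)(d-1)⁻¹ ∂ᵢ∂ⱼΔ⁻¹D`, `D = Σₗ ∂ₗΔ⁻¹vₗ`) composed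
with one derivative is an operator of order `0`; on `L^p(𝕋^d)`, `1 < p < ∞`, it is bounded:

  `‖ℛ(∂ₘ B)‖_{L^p(𝕋^d)} ≤ C ‖B‖_{L^p(𝕋^d)}`   (`B : 𝕋^d → ℝ^d` smooth, `m` a coordinate).

This is the bound "`‖ℛ curl‖_{L^p→L^p} ≲ 1`" / "`‖|∇|ℛ‖_{L^p → L^p} ≲ 1`" of the intermittent
convex-integration schemes (Buckmaster–Vicol, Ann. of Math. 189 (2019), §5.1; Buckmaster–Vicol,
EMS Surv. Math. Sci. 6 (2019), §7.6.2: "Calderón-Zygmund operators are bounded on `L^p` …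
using that `ℛ curl` is a bounded operator on `L^p`"), with which the linear error
`ℛ ∂ₜ(w^{(p)} + w^{(c)}) = ℛ div ∂ₜ(a Ω)` is controlled. It is derived here from the tree's
PROVED Calderón–Zygmund bound for the Hessian, `Torus.eLpNorm_hessian_le_laplacian_holds`
(`FunctionSpaces/TorusRieszTransformProofs`: `‖∂ⱼ∂ₖw‖_p ≤ C‖Δw‖_p`): every entry of `ℛ(∂ₘB)` is a
sum of `∂ᵢ∂ₘΔ⁻¹Bⱼ`, of `D = Σₗ ∂ₗ∂ₘΔ⁻¹Bₗ`, and of `∂ᵢ∂ⱼΔ⁻¹D` (`∂ₘΔ⁻¹ = Δ⁻¹∂ₘ`,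
`Torus.partialDeriv_invLaplacian`), and `ΔΔ⁻¹h = h - ⨍h` with `‖h - ⨍h‖_p ≤ 2‖h‖_p`.

## Main statements

* `Torus.exists_eLpNorm_antidivergence_partialDeriv_le`: for `1 < p < ∞` a constant `C = C(d,p)`
  with `‖ℛ(∂ₘB)‖_p ≤ C ‖B‖_p` for all smooth `B` and all `m`.

## References

* T. Buckmaster, V. Vicol, EMS Surv. Math. Sci. 6 (2019) 173–263 = arXiv:1901.09023, §7.6.2
  (linear error). [`BuckmasterVicol2020`]
* T. Buckmaster, V. Vicol, Ann. of Math. 189 (2019) = arXiv:1709.10033, §5.1. [`BuckmasterVicol2019AnnMath`]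
* A. Cheskidov, X. Luo, Invent. Math. 229 (2022) = arXiv:2009.06596, §7.2 Def. 7.2, Thm. 7.3.
  [`CheskidovLuo2022`]
-/

noncomputable section

open MeasureTheory Set Filter Function UnitAddTorus
open scoped ENNReal NNReal ContDiff

namespace Literature.Analysis.FluidPDE

namespace Torus

open FunctionSpaces FunctionSpaces.Torus

variable {d : Type*} [Fintype d] [DecidableEq d]

/-! ## The derivative of a field as the argument of `ℛ` -/

section Pieces

variable {B : UnitAddTorus d → EuclideanSpace ℝ d}

/-- Coordinates of `∂ₘB`: `(∂ₘB)ⱼ = ∂ₘ(Bⱼ)`. [folklore] -/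
theorem partialDeriv_field_apply (hB : IsSmooth B) (m : d) (y : UnitAddTorus d) (j : d) :
    Torus.partialDeriv m B y j = Torus.partialDeriv m (fun z => B z j) y :=
  (partialDeriv_apply_coord (hB.isContDiff (by simp)) m y j).symm

/-- The potentials of `ℛ(∂ₘB)`: `Δ⁻¹(∂ₘB)ⱼ = ∂ₘ Δ⁻¹Bⱼ`. [folklore] -/
theorem antidivPotential_partialDeriv (hB : IsSmooth B) (m j : d) :
    antidivPotential (Torus.partialDeriv m B) j = Torus.partialDeriv m (invLaplacian fun z => B z j) := by
  funext y
  have e : (fun y => Torus.partialDeriv m B y j) = Torus.partialDeriv m (fun z => B z j) :=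
    funext fun y => partialDeriv_field_apply hB m y j
  rw [antidivPotential, e, partialDeriv_invLaplacian (hB.apply j) m y]

omit [DecidableEq d] in
/-- `‖Δ(Δ⁻¹h)‖_p ≤ 2‖h‖_p` (`ΔΔ⁻¹h = h - ⨍h`). [folklore] -/
theorem eLpNorm_laplacian_invLaplacian_le [Nonempty d] {h : UnitAddTorus d → ℝ} (hh : IsSmooth h)
    {p : ℝ≥0∞} (hp : 1 ≤ p) :
    eLpNorm (Torus.laplacian (invLaplacian h)) p volume ≤ 2 * eLpNorm h p volume := by
  have e : Torus.laplacian (invLaplacian h) = fun y => h y - ∫ z, h z := funext (laplacian_invLaplacian hh)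
  rw [e]
  exact eLpNorm_sub_integral_le_two_mul hh.continuous.aestronglyMeasurable hp

variable [Nonempty d]

/-- **The mixed second derivatives of `Δ⁻¹`**: `‖∂ᵢ∂ₖΔ⁻¹h‖_p ≤ 2C‖h‖_p` from the Hessian bound with
constant `C`. [folklore] -/
theorem eLpNorm_partialDeriv_partialDeriv_invLaplacian_le_of_hessian {p : ℝ≥0∞} (hp : 1 ≤ p) {C : ℝ≥0}
    (hC : ∀ w : UnitAddTorus d → ℝ, IsSmooth w → ∀ j k : d,
      eLpNorm (Torus.partialDeriv j (Torus.partialDeriv k w)) p volume ≤ C * eLpNorm (Torus.laplacian w) p volume)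
    {h : UnitAddTorus d → ℝ} (hh : IsSmooth h) (i k : d) :
    eLpNorm (Torus.partialDeriv i (Torus.partialDeriv k (invLaplacian h))) p volume ≤
      (2 * C : ℝ≥0) * eLpNorm h p volume := by
  calc eLpNorm (Torus.partialDeriv i (Torus.partialDeriv k (invLaplacian h))) p volume
      ≤ C * eLpNorm (Torus.laplacian (invLaplacian h)) p volume := hC _ (isSmooth_invLaplacian hh) i k
    _ ≤ C * (2 * eLpNorm h p volume) := mul_le_mul' le_rfl (eLpNorm_laplacian_invLaplacian_le hh hp)
    _ = ((2 * C : ℝ≥0) : ℝ≥0∞) * eLpNorm h p volume := by push_cast; ring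

/-- First piece: `‖∂ᵢ Δ⁻¹(∂ₘB)ⱼ‖_p = ‖∂ᵢ∂ₘΔ⁻¹Bⱼ‖_p ≤ 2C‖B‖_p`. [folklore] -/
theorem eLpNorm_partialDeriv_antidivPotential_partialDeriv_le {p : ℝ≥0∞} (hp : 1 ≤ p) {C : ℝ≥0}
    (hC : ∀ w : UnitAddTorus d → ℝ, IsSmooth w → ∀ j k : d,
      eLpNorm (Torus.partialDeriv j (Torus.partialDeriv k w)) p volume ≤ C * eLpNorm (Torus.laplacian w) p volume)
    (hB : IsSmooth B) (m i j : d) :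
    eLpNorm (Torus.partialDeriv i (antidivPotential (Torus.partialDeriv m B) j)) p volume ≤
      (2 * C : ℝ≥0) * eLpNorm B p volume := by
  rw [antidivPotential_partialDeriv hB m j]
  exact (eLpNorm_partialDeriv_partialDeriv_invLaplacian_le_of_hessian hp hC (hB.apply j) i m).trans
    (mul_le_mul' le_rfl (eLpNorm_apply_le B j p))

omit [Nonempty d] in
/-- `D = Σₗ ∂ₗΔ⁻¹(∂ₘB)ₗ = Σₗ ∂ₗ∂ₘΔ⁻¹Bₗ`, pointwise. [folklore] -/
theorem antidivDiv_partialDeriv_eq (hB : IsSmooth B) (m : d) :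
    antidivDiv (Torus.partialDeriv m B) =
      ∑ l : d, Torus.partialDeriv l (Torus.partialDeriv m (invLaplacian fun z => B z l)) := by
  funext y
  simp only [antidivDiv, Finset.sum_apply, antidivPotential_partialDeriv hB m]

/-- Second piece: `‖D‖_p ≤ 2 d C ‖B‖_p`. [folklore] -/
theorem eLpNorm_antidivDiv_partialDeriv_le {p : ℝ≥0∞} (hp : 1 ≤ p) {C : ℝ≥0}
    (hC : ∀ w : UnitAddTorus d → ℝ, IsSmooth w → ∀ j k : d,
      eLpNorm (Torus.partialDeriv j (Torus.partialDeriv k w)) p volume ≤ C * eLpNorm (Torus.laplacian w) p volume)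
    (hB : IsSmooth B) (m : d) :
    eLpNorm (antidivDiv (Torus.partialDeriv m B)) p volume ≤
      (Fintype.card d * (2 * C) : ℝ≥0) * eLpNorm B p volume := by
  rw [antidivDiv_partialDeriv_eq hB m]
  have hmeas : ∀ l, AEStronglyMeasurable
      (Torus.partialDeriv l (Torus.partialDeriv m (invLaplacian fun z => B z l))) volume := fun l =>
    (((isSmooth_invLaplacian (hB.apply l)).partialDeriv m).partialDeriv l).continuous.aestronglyMeasurable
  calc eLpNorm (∑ l : d, Torus.partialDeriv l (Torus.partialDeriv m (invLaplacian fun z => B z l))) p volume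
      ≤ ∑ l : d, eLpNorm (Torus.partialDeriv l (Torus.partialDeriv m (invLaplacian fun z => B z l))) p volume :=
        eLpNorm_sum_le (fun l _ => hmeas l) hp
    _ ≤ ∑ _l : d, ((2 * C : ℝ≥0) : ℝ≥0∞) * eLpNorm B p volume :=
        Finset.sum_le_sum fun l _ =>
          (eLpNorm_partialDeriv_partialDeriv_invLaplacian_le_of_hessian hp hC (hB.apply l) l m).trans
            (mul_le_mul' le_rfl (eLpNorm_apply_le B l p))
    _ = ((Fintype.card d * (2 * C) : ℝ≥0) : ℝ≥0∞) * eLpNorm B p volume := by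
        rw [Finset.sum_const, Finset.card_univ, nsmul_eq_mul]; push_cast; ring

/-- Third piece: `‖∂ᵢ∂ⱼΔ⁻¹D‖_p ≤ 2C · 2dC ‖B‖_p`. [folklore] -/
theorem eLpNorm_hessian_antidivPhi_partialDeriv_le {p : ℝ≥0∞} (hp : 1 ≤ p) {C : ℝ≥0}
    (hC : ∀ w : UnitAddTorus d → ℝ, IsSmooth w → ∀ j k : d,
      eLpNorm (Torus.partialDeriv j (Torus.partialDeriv k w)) p volume ≤ C * eLpNorm (Torus.laplacian w) p volume)
    (hB : IsSmooth B) (m i j : d) :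
    eLpNorm (Torus.partialDeriv i (Torus.partialDeriv j (antidivPhi (Torus.partialDeriv m B)))) p volume ≤
      (2 * C * (Fintype.card d * (2 * C)) : ℝ≥0) * eLpNorm B p volume := by
  have hv : IsSmooth (Torus.partialDeriv m B) := hB.partialDeriv m
  have hD : IsSmooth (antidivDiv (Torus.partialDeriv m B)) := isSmooth_antidivDiv hv
  calc eLpNorm (Torus.partialDeriv i (Torus.partialDeriv j (antidivPhi (Torus.partialDeriv m B)))) p volume
      ≤ ((2 * C : ℝ≥0) : ℝ≥0∞) * eLpNorm (antidivDiv (Torus.partialDeriv m B)) p volume :=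
        eLpNorm_partialDeriv_partialDeriv_invLaplacian_le_of_hessian hp hC hD i j
    _ ≤ ((2 * C : ℝ≥0) : ℝ≥0∞) * (((Fintype.card d * (2 * C) : ℝ≥0) : ℝ≥0∞) * eLpNorm B p volume) :=
        mul_le_mul' le_rfl (eLpNorm_antidivDiv_partialDeriv_le hp hC hB m)
    _ = _ := by push_cast; ring

/-- **`L^p` bound for one entry of `ℛ(∂ₘB)`**, from the Hessian bound with constant `C`. [folklore] -/
theorem eLpNorm_antidivEntry_partialDeriv_le {p : ℝ≥0∞} (hp : 1 ≤ p) {C : ℝ≥0}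
    (hC : ∀ w : UnitAddTorus d → ℝ, IsSmooth w → ∀ j k : d,
      eLpNorm (Torus.partialDeriv j (Torus.partialDeriv k w)) p volume ≤ C * eLpNorm (Torus.laplacian w) p volume)
    (hB : IsSmooth B) (m i j : d) :
    eLpNorm (antidivEntry (Torus.partialDeriv m B) i j) p volume ≤
      ((2 * (2 * C) + Real.toNNReal |1 / ((Fintype.card d : ℝ) - 1)| * (Fintype.card d * (2 * C)) +
        Real.toNNReal |(2 - (Fintype.card d : ℝ)) / ((Fintype.card d : ℝ) - 1)| *
          (2 * C * (Fintype.card d * (2 * C))) : ℝ≥0) : ℝ≥0∞) * eLpNorm B p volume := by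
  set v := Torus.partialDeriv m B with hv_def
  have hv : IsSmooth v := hB.partialDeriv m
  set N : ℝ := (Fintype.card d : ℝ) with hN
  set c₁ : ℝ := 1 / (N - 1) with hc₁
  set c₂ : ℝ := (2 - N) / (N - 1) with hc₂
  set f₁ := Torus.partialDeriv i (antidivPotential v j) with hf₁
  set f₂ := Torus.partialDeriv j (antidivPotential v i) with hf₂
  set f₃ : UnitAddTorus d → ℝ := fun y => c₁ * (if i = j then antidivDiv v y else 0) with hf₃
  set f₄ : UnitAddTorus d → ℝ :=
    fun y => c₂ * Torus.partialDeriv i (Torus.partialDeriv j (antidivPhi v)) y with hf₄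
  have hm₁ : AEStronglyMeasurable f₁ volume :=
    ((isSmooth_antidivPotential hv j).partialDeriv i).continuous.aestronglyMeasurable
  have hm₂ : AEStronglyMeasurable f₂ volume :=
    ((isSmooth_antidivPotential hv i).partialDeriv j).continuous.aestronglyMeasurable
  have hm₃ : AEStronglyMeasurable f₃ volume :=
    (isSmooth_ite_antidivDiv hv i j).continuous.aestronglyMeasurable.const_mul _
  have hm₄ : AEStronglyMeasurable f₄ volume :=
    (((isSmooth_antidivPhi hv).partialDeriv j).partialDeriv i).continuous.aestronglyMeasurable.const_mul _
  have e : antidivEntry v i j = fun y => ((f₁ y + f₂ y) - f₃ y) + f₄ y := rfl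
  have b₁ : eLpNorm f₁ p volume ≤ ((2 * C : ℝ≥0) : ℝ≥0∞) * eLpNorm B p volume :=
    eLpNorm_partialDeriv_antidivPotential_partialDeriv_le hp hC hB m i j
  have b₂ : eLpNorm f₂ p volume ≤ ((2 * C : ℝ≥0) : ℝ≥0∞) * eLpNorm B p volume :=
    eLpNorm_partialDeriv_antidivPotential_partialDeriv_le hp hC hB m j i
  have b₃ : eLpNorm f₃ p volume ≤
      (Real.toNNReal |c₁| * (Fintype.card d * (2 * C)) : ℝ≥0) * eLpNorm B p volume := by
    have e3 : f₃ = c₁ • fun y => (if i = j then antidivDiv v y else 0) := rfl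
    rw [e3, eLpNorm_const_smul, Real.enorm_eq_ofReal_abs, ENNReal.ofReal, ENNReal.coe_mul, mul_assoc]
    refine mul_le_mul' le_rfl ?_
    by_cases hij : i = j
    · simp only [hij, if_true]; exact eLpNorm_antidivDiv_partialDeriv_le hp hC hB m
    · simp only [hij, if_false, eLpNorm_zero']; exact bot_le
  have b₄ : eLpNorm f₄ p volume ≤
      (Real.toNNReal |c₂| * (2 * C * (Fintype.card d * (2 * C))) : ℝ≥0) * eLpNorm B p volume := by
    have e4 : f₄ = c₂ • Torus.partialDeriv i (Torus.partialDeriv j (antidivPhi v)) := rfl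
    rw [e4, eLpNorm_const_smul, Real.enorm_eq_ofReal_abs, ENNReal.ofReal, ENNReal.coe_mul, mul_assoc]
    exact mul_le_mul' le_rfl (eLpNorm_hessian_antidivPhi_partialDeriv_le hp hC hB m i j)
  rw [e]
  calc eLpNorm (fun y => ((f₁ y + f₂ y) - f₃ y) + f₄ y) p volume
      ≤ eLpNorm (fun y => (f₁ y + f₂ y) - f₃ y) p volume + eLpNorm f₄ p volume :=
        eLpNorm_add_le ((hm₁.add hm₂).sub hm₃) hm₄ hp
    _ ≤ (eLpNorm (fun y => f₁ y + f₂ y) p volume + eLpNorm f₃ p volume) + eLpNorm f₄ p volume := by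
        gcongr; exact eLpNorm_sub_le (hm₁.add hm₂) hm₃ hp
    _ ≤ ((eLpNorm f₁ p volume + eLpNorm f₂ p volume) + eLpNorm f₃ p volume) + eLpNorm f₄ p volume := by
        gcongr; exact eLpNorm_add_le hm₁ hm₂ hp
    _ ≤ (((((2 * C : ℝ≥0) : ℝ≥0∞) * eLpNorm B p volume + ((2 * C : ℝ≥0) : ℝ≥0∞) * eLpNorm B p volume) +
          (Real.toNNReal |c₁| * (Fintype.card d * (2 * C)) : ℝ≥0) * eLpNorm B p volume) +
          (Real.toNNReal |c₂| * (2 * C * (Fintype.card d * (2 * C))) : ℝ≥0) * eLpNorm B p volume) := by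
        gcongr
    _ = _ := by
        rw [← add_mul, ← add_mul, ← add_mul]
        push_cast
        ring

end Pieces

/-! ## The operator bound -/

/-- **`ℛ∂ₘ` is bounded on `L^p(𝕋^d)`, `1 < p < ∞`, `d ≥ 2`**: `‖ℛ(∂ₘB)‖_{L^p} ≤ C ‖B‖_{L^p}` for all
smooth `B : 𝕋^d → ℝ^d` and all coordinates `m`, with `C = C(d, p)` (the norm of the tensor
`ℛ(∂ₘB)(y) : d → ℝ^d` is the sup over columns of the Euclidean column norms, as in
`Torus.IsNSReynoldsOn`). From the Calderón–Zygmund Hessian bound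
`Torus.eLpNorm_hessian_le_laplacian_holds`. [cite: BuckmasterVicol2020, §7.6.2] -/
theorem exists_eLpNorm_antidivergence_partialDeriv_le (hd : 2 ≤ Fintype.card d) {p : ℝ≥0∞}
    (hp1 : 1 < p) (hp : p < ⊤) :
    ∃ C : ℝ≥0, ∀ B : UnitAddTorus d → EuclideanSpace ℝ d, IsSmooth B → ∀ m : d,
      eLpNorm (antidivergence (Torus.partialDeriv m B)) p volume ≤ C * eLpNorm B p volume := by
  haveI : Nonempty d := Fintype.card_pos_iff.1 (by omega)
  obtain ⟨C, hC⟩ := eLpNorm_hessian_le_laplacian_holds (d := d) p hp1 hp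
  set K : ℝ≥0 := 2 * (2 * C) + Real.toNNReal |1 / ((Fintype.card d : ℝ) - 1)| * (Fintype.card d * (2 * C)) +
    Real.toNNReal |(2 - (Fintype.card d : ℝ)) / ((Fintype.card d : ℝ) - 1)| *
      (2 * C * (Fintype.card d * (2 * C))) with hK
  refine ⟨Fintype.card d * Fintype.card d * K, fun B hB m => ?_⟩
  set v := Torus.partialDeriv m B with hv_def
  have hv : IsSmooth v := hB.partialDeriv m
  have hent : ∀ i j, eLpNorm (antidivEntry v i j) p volume ≤ (K : ℝ≥0∞) * eLpNorm B p volume :=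
    fun i j => eLpNorm_antidivEntry_partialDeriv_le hp1.le hC hB m i j
  have hmeas : ∀ i j, AEStronglyMeasurable (fun y => |antidivEntry v i j y|) volume := fun i j =>
    (isSmooth_antidivEntry hv i j).continuous.abs.aestronglyMeasurable
  have hpt : ∀ y, ‖antidivergence v y‖ ≤ ∑ q : d × d, |antidivEntry v q.2 q.1 y| := by
    intro y
    refine (norm_tensor_le_sum_sum_abs (antidivergence v y)).trans (le_of_eq ?_)
    rw [Fintype.sum_prod_type]
    simp [antidivergence_apply]
  have e : (fun y => ∑ q : d × d, |antidivEntry v q.2 q.1 y|) =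
      ∑ q : d × d, fun y => |antidivEntry v q.2 q.1 y| :=
    (Finset.sum_fn _ _).symm
  calc eLpNorm (antidivergence v) p volume
      ≤ eLpNorm (fun y => ∑ q : d × d, |antidivEntry v q.2 q.1 y|) p volume := eLpNorm_mono_real hpt
    _ = eLpNorm (∑ q : d × d, fun y => |antidivEntry v q.2 q.1 y|) p volume := by rw [e]
    _ ≤ ∑ q : d × d, eLpNorm (fun y => |antidivEntry v q.2 q.1 y|) p volume :=
        eLpNorm_sum_le (fun q _ => hmeas q.2 q.1) hp1.le
    _ = ∑ q : d × d, eLpNorm (antidivEntry v q.2 q.1) p volume :=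
        Finset.sum_congr rfl fun q _ => eLpNorm_norm (antidivEntry v q.2 q.1)
    _ ≤ ∑ _q : d × d, (K : ℝ≥0∞) * eLpNorm B p volume := Finset.sum_le_sum fun q _ => hent q.2 q.1
    _ = ((Fintype.card d * Fintype.card d * K : ℝ≥0) : ℝ≥0∞) * eLpNorm B p volume := by
        rw [Finset.sum_const, Finset.card_univ, Fintype.card_prod, nsmul_eq_mul]
        push_cast
        ring

/-- **`ℛ div` on `L^p`**: for a smooth tensor `A : 𝕋^d → (d → ℝ^d)` (columns `A y m`),
`‖ℛ(div A)‖_{L^p} ≤ C Σₘ ‖A(·) m‖_{L^p}`, `1 < p < ∞` (`div A = Σₘ ∂ₘ(A·m)`,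
`Torus.tensorDivergence`). [cite: BuckmasterVicol2020, §7.6.2] -/
theorem exists_eLpNorm_antidivergence_tensorDivergence_le (hd : 2 ≤ Fintype.card d) {p : ℝ≥0∞}
    (hp1 : 1 < p) (hp : p < ⊤) :
    ∃ C : ℝ≥0, ∀ A : UnitAddTorus d → d → EuclideanSpace ℝ d, IsSmooth A →
      eLpNorm (antidivergence (tensorDivergence A)) p volume ≤
        C * ∑ m, eLpNorm (fun y => A y m) p volume := by
  obtain ⟨C, hC⟩ := exists_eLpNorm_antidivergence_partialDeriv_le (d := d) hd hp1 hp
  refine ⟨C, fun A hA => ?_⟩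
  have hcol : ∀ m, IsSmooth (fun y => A y m) := fun m => hA.column m
  -- `ℛ` is additive on smooth fields: work entrywise through linearity of `Δ⁻¹` and `∂`
  have hdiv : tensorDivergence A = ∑ m, Torus.partialDeriv m (fun z => A z m) := by
    funext y; simp [tensorDivergence, Finset.sum_apply]
  have hsm : ∀ m, IsSmooth (Torus.partialDeriv m (fun z => A z m)) := fun m => (hcol m).partialDeriv m
  have hlin : antidivergence (tensorDivergence A) =
      ∑ m, antidivergence (Torus.partialDeriv m (fun z => A z m)) := by
    rw [hdiv]
    exact antidivergence_finset_sum Finset.univ (fun m _ => hsm m)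
  rw [hlin]
  have hmeas : ∀ m, AEStronglyMeasurable (antidivergence (Torus.partialDeriv m (fun z => A z m))) volume :=
    fun m => (isSmooth_antidivergence (hsm m)).continuous.aestronglyMeasurable
  calc eLpNorm (∑ m, antidivergence (Torus.partialDeriv m (fun z => A z m))) p volume
      ≤ ∑ m, eLpNorm (antidivergence (Torus.partialDeriv m (fun z => A z m))) p volume :=
        eLpNorm_sum_le (fun m _ => hmeas m) hp1.le
    _ ≤ ∑ m, (C : ℝ≥0∞) * eLpNorm (fun y => A y m) p volume :=
        Finset.sum_le_sum fun m _ => hC _ (hcol m) m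
    _ = C * ∑ m, eLpNorm (fun y => A y m) p volume := by rw [Finset.mul_sum]

end Torus

end Literature.Analysis.FluidPDE
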